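import Literature.AlgebraicGeometry.RealAlgebraic.ComplexOrientationFormula
import Literature.AlgebraicGeometry.RealAlgebraic.DividingCurvesSemialgebraic
import Literature.NumberTheory.Transcendental.ZeroLocusConnectedProofs
import Literature.Topology.CompactHull
import HarnessLib

/-!
# Rokhlin's complex orientation formula, integrated — groundwork for the proof (layer 0)

Groundwork file for the proof of the second named fact of `ComplexOrientationFormula.lean`
(the first one, `complexOrientationSign_isUnit_of_isDividing`, is discharged in
`ComplexOrientationFormulaProofs.lean`). That named fact
`rokhlin_sum_sign_mul_area_ovalInterior_mem_algebraic_mul_pi` (Rokhlin 1974, §§2–3, read through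
Stokes/residues; Hagg–Shapiro 2026, Cor. 5.5) says: for `p ∈ ℚ[x,y]` with compact real locus,
nonsingular geometrically irreducible dividing complex affine curve, and a half `H`, the signed
sum over the ovals `O` of `complexOrientationSign p H O · Area(ovalInterior O)` is a real
algebraic multiple of `π`.  The fact is NOT discharged here.  This file proves the elementary
reductions every proof starts from ("layer 0"), all from Mathlib and the tree:

* `finite_setOf_oval`, `finsum_mem_setOf_oval_eq_sum` — the real locus of `p` is
  `ℚ`-semialgebraic, so it has finitely many connected components (ovals)
  (`Literature.ModelTheory.ExponentialFields.IsSemialgebraic.finite_setOf_connectedComponentIn`,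
  [BasuPollackRoy2006, Thm. 5.22]); the `finsum` of the fact is an honest finite sum.
* `isClosed_oval`, `isCompact_oval`, `isConnected_oval` — ovals are compact connected subsets of
  the real locus.
* `isOpen_ovalInterior_of_isCompact`, `ovalInterior_subset_closedBall`, `isBounded_ovalInterior`,
  `volume_ovalInterior_lt_top` — the interior of a compact planar set (union of the bounded
  complementary components) is open, lies in every closed ball about `0` containing the set (a
  ray leaving the ball is an unbounded connected set off `O`), hence is bounded of finite area:
  the real numbers `(volume (ovalInterior O)).toReal` in the fact are genuine areas.
* `exists_aeval_pderiv_ne_zero_real`, `realGrad_ne_zero` — the complex nonsingularity hypothesis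
  of the fact gives a nowhere vanishing real gradient on the real locus.
* `isConnected_complexZeroLocus` — the complex affine curve of a geometrically irreducible
  `p ∈ ℚ[x,y]` is connected in the classical topology (Shafarevich, *Basic Algebraic Geometry 2*,
  VII §2 Thm. 7.1, in the tree as
  `Literature.NumberTheory.Transcendental.isConnected_zeroLocus_of_isPrime_holds`); this is the
  global input of Rokhlin's two-halves theorem (the non-real locus of a dividing curve has exactly
  two components, interchanged by `conj`).
* `finsum_sign_mul_area_image_star`, `rokhlinConclusion_image_star` — the value attached to the
  conjugate half `conj '' H` is the negative of the value attached to `H`, so the conclusion of the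
  fact for `H` and for `conj '' H` are equivalent (Rokhlin: the two complex orientations are
  opposite); `rokhlinConclusion_of_realLocus_eq_empty` — the degenerate case of an empty real
  locus (empty sum, `β = 0`).
* `measurePreserving_shearCoord`, `volume_eq_lintegral_volume_shearSlice`,
  `volume_toReal_eq_integral_shearSlice`, `volume_ovalInterior_toReal_eq_integral_shearSlice` —
  **Cavalieri along the lines `x - c y = ξ`** (the first step of layer 4 below): the sheared
  coordinates `(ξ, y) ↦ (ξ + c y, y)` preserve Lebesgue measure (determinant `1`), so the area of
  a bounded measurable planar set — in particular of `ovalInterior O` — is the integral over `ξ`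
  of the lengths of its slices `{y | (ξ + c y, y) ∈ S} ⊆ [-R, R]`.
* `ShearMonic.exists_shear_natDegree_eq`, `ShearMonic.natDegree_map_shear`,
  `ShearMonic.aevalTower_aeval_shear` — **a rational shear makes the curve monic in `y`** (the
  normalisation behind layers 4–6): for `p ≠ 0` there are `c, a ∈ ℚ`, `a ≠ 0`, with
  `p(ξ + cY, Y) ∈ ℚ[ξ][Y]` of `Y`-degree `deg p` and constant leading coefficient `a` (the
  coefficient of `Y^d` is the leading form of `p` at `(c, 1)`, a non-zero polynomial in `c`), so
  that over every `ξ₀` the fibre is the root set of a degree-`d` polynomial with leading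
  coefficient `a`.
* `eq_zero_of_eventually_sum_rpow_smul_eq` — **uniqueness of a divergent asymptotic expansion**
  `Σ_q R^q • c_q + C + o(1)` (`q > 0`): if it is eventually constant then all `c_q = 0` and the
  constant is `C` (layer 6: the contour integral at infinity is constant in `R` because `J` has
  compact support).
* `ShearMonic.natDegree_fibre`, `ShearMonic.norm_root_fibre_le`, `ShearMonic.continuous_rootBound`,
  `ShearMonic.sum_roots_fibre`, `ShearMonic.card_roots_fibre` — fibres of a `Y`-monic family
  `Q ∈ ℚ[ξ][Y]`: degree `d` and leading coefficient `a` over every `ξ₀ ∈ ℂ`, `d` roots, a root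
  bound continuous in `ξ₀` (Cauchy's bound), and Vieta `Σ roots = -Q_{d-1}(ξ₀)/a` (layer 5).

## Blueprint of the remaining layers (recorded for the continuation; nothing below is used)

1. Local structure of the complex curve at a nonsingular REAL point `v` (holomorphic implicit
   function theorem for `p` with real coefficients): in a neighbourhood, the non-real locus is the
   disjoint union of two connected half-branches `D₊`, `D₋ = conj D₊`, the real points form an arc,
   and `⟪Im w, J∇p(v)⟫` has constant sign on each half-branch; whence `halfSideSign p H v = ±1`
   as soon as exactly one half-branch lies in `H`.
2. Two halves (Rokhlin): with `isConnected_complexZeroLocus`, finiteness of halves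
   (`finite_setOf_isHalf`) and 1., a dividing nonsingular geometrically irreducible curve has
   exactly the halves `H`, `conj '' H ≠ H`, and at every real point the two half-branches lie in
   `H` and `conj '' H` respectively.
3. Ovals are smooth Jordan curves (flow of `J∇p` on the compact nonsingular real locus), the
   Jordan curve theorem of the tree (`Literature.Topology.PlaneTopology.JordanCurveTheorem_holds`)
   identifies `ovalInterior O` with the inside, `∇p` is transverse so `gradOutwardSign = ±1`, and
   both signs are locally constant along `O`: `complexOrientationSign p H O = ±1` (this is the
   sibling named fact `complexOrientationSign_isUnit_of_isDividing`).
4. Cavalieri instead of Green: after a rational shear making `p` monic in `y`, for almost every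
   real `x` the vertical slice of `ovalInterior O` is a finite union of intervals with endpoints
   on the real sheets `y_j(x)` of `O`, so `Σ_O ε_O Area(ovalInterior O) = -∫_ℝ J(x) dx` with
   `J(x) = Σ_{real sheets} ε_j^H y_j(x)`, `ε_j^H = ±1` recording which half-branch of sheet `j`
   lies in `H` (by 1.–3., `ε_j^H = -ε_O σ_j`, `σ_j = ±1` the top/bottom type of the sheet).
5. Sheets over the upper half `x`-plane: `G₊(x) = Σ_{(x,y) ∈ H} y` is holomorphic on `Im x > 0`
   (fibre sums over a half are single valued; bounded near branch points, Riemann), and on the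
   real axis `J = 2 Re G₊(· + i0) - e₁` with `e₁(x) = Σ_all y_j(x) ∈ ℚ[x]`; `J` has compact
   support.
6. Cauchy on `{Im x ≥ δ} ∩ {|x| ≤ R}`, `δ → 0`, and the convergent Puiseux expansions at infinity
   of the sheets (`Literature.Analysis.Complex.PuiseuxInfinity.exists_branches_at_infinity`, with
   coefficients in `ℚ̄`): `∫_{-R}^{R} J = Σ_q c_q R^q + π · Im Σ_j η_j a_j^{(-1)} + o(1)` is
   constant in `R`, hence equals `π` times the (real algebraic) number `Im Σ_j η_j a_j^{(-1)}`,
   `a_j^{(-1)}` the coefficient of `x^{-1}` of sheet `j` at infinity and `η_j = ±1` its half.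

## References

* [Rokhlin1974] V. A. Rokhlin, Complex orientations of real algebraic curves, Funct. Anal. Appl.
  8 (1974) 331–334, §§2–3.
* [DegtyarevKharlamov2000] A. Degtyarev, V. Kharlamov, Topological properties of real algebraic
  varieties: du côté de chez Rokhlin, Russian Math. Surveys 55 (2000), arXiv:math/0004134, §1.
* [HaggShapiro2026] Ch. Hagg, B. Shapiro, Algebraicity of exterior Cauchy transforms of algebraic
  ovals, arXiv:2606.06296, §5, Cor. 5.5.
* [BasuPollackRoy2006] S. Basu, R. Pollack, M.-F. Roy, Algorithms in Real Algebraic Geometry,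
  Springer 2006, Thm. 5.22.
* [Shafarevich1994] I. R. Shafarevich, Basic Algebraic Geometry 2, Springer 1994, Book 3,
  Ch. VII §2, Thm. 7.1.
-/

noncomputable section

open MvPolynomial Set Bornology
open _root_.MeasureTheory
open Literature.ModelTheory.ExponentialFields (IsSemialgebraic isSemialgebraic_setOf_eval_eq_zero
  isClosed_setOf_aeval_eq_zero)

namespace Literature.AlgebraicGeometry.RealAlgebraic

/-! ### The real locus and its ovals -/

section RealLocus

variable (p : MvPolynomial (Fin 2) ℚ)

/-- The real locus `{v ∈ ℝ² | p(v) = 0}` of `p ∈ ℚ[x,y]` is `ℚ`-semialgebraic.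
[cite: BasuPollackRoy2006, Thm. 5.22] -/
theorem isSemialgebraic_realLocus : IsSemialgebraic ℚ {v : Fin 2 → ℝ | aeval v p = 0} :=
  isSemialgebraic_setOf_eval_eq_zero p

/-- The real locus of `p` is closed. [folklore] -/
theorem isClosed_realLocus : IsClosed {v : Fin 2 → ℝ | aeval v p = 0} :=
  isClosed_setOf_aeval_eq_zero p

/-- **Finitely many ovals**: the real locus of `p ∈ ℚ[x,y]` has finitely many connected
components (the index set of the sum in
`rokhlin_sum_sign_mul_area_ovalInterior_mem_algebraic_mul_pi`).
[cite: BasuPollackRoy2006, Thm. 5.22] -/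
theorem finite_setOf_oval :
    {O : Set (Fin 2 → ℝ) | ∃ v : Fin 2 → ℝ, aeval v p = 0 ∧
      O = connectedComponentIn {u : Fin 2 → ℝ | aeval u p = 0} v}.Finite := by
  refine (isSemialgebraic_realLocus p).finite_setOf_connectedComponentIn.subset ?_
  rintro O ⟨v, hv, rfl⟩
  exact ⟨v, hv, rfl⟩

/-- The sum over the ovals in Rokhlin's integrated formula is a finite sum. [folklore] -/
theorem finsum_mem_setOf_oval_eq_sum (f : Set (Fin 2 → ℝ) → ℝ) :
    ∑ᶠ O ∈ {O : Set (Fin 2 → ℝ) | ∃ v : Fin 2 → ℝ, aeval v p = 0 ∧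
        O = connectedComponentIn {u : Fin 2 → ℝ | aeval u p = 0} v}, f O =
      ∑ O ∈ (finite_setOf_oval p).toFinset, f O :=
  finsum_mem_eq_finite_toFinset_sum f _

variable {p}

/-- An oval lies in the real locus. [folklore] -/
theorem oval_subset_realLocus {O : Set (Fin 2 → ℝ)}
    (hO : ∃ v : Fin 2 → ℝ, aeval v p = 0 ∧ O = connectedComponentIn {u : Fin 2 → ℝ | aeval u p = 0} v) :
    O ⊆ {u : Fin 2 → ℝ | aeval u p = 0} := by
  obtain ⟨v, -, rfl⟩ := hO
  exact connectedComponentIn_subset _ _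

/-- An oval is connected (in particular nonempty). [folklore] -/
theorem isConnected_oval {O : Set (Fin 2 → ℝ)}
    (hO : ∃ v : Fin 2 → ℝ, aeval v p = 0 ∧ O = connectedComponentIn {u : Fin 2 → ℝ | aeval u p = 0} v) :
    IsConnected O := by
  obtain ⟨v, hv, rfl⟩ := hO
  exact isConnected_connectedComponentIn_iff.2 hv

/-- An oval is closed (a connected component of the closed real locus). [folklore] -/
theorem isClosed_oval {O : Set (Fin 2 → ℝ)}
    (hO : ∃ v : Fin 2 → ℝ, aeval v p = 0 ∧ O = connectedComponentIn {u : Fin 2 → ℝ | aeval u p = 0} v) :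
    IsClosed O := by
  obtain ⟨v, -, rfl⟩ := hO
  exact Literature.Topology.isClosed_connectedComponentIn_of_closure_subset
    (closure_minimal (connectedComponentIn_subset _ _) (isClosed_realLocus p))

/-- When the real locus is compact, every oval is compact. [folklore] -/
theorem isCompact_oval (hcpt : IsCompact {v : Fin 2 → ℝ | aeval v p = 0}) {O : Set (Fin 2 → ℝ)}
    (hO : ∃ v : Fin 2 → ℝ, aeval v p = 0 ∧ O = connectedComponentIn {u : Fin 2 → ℝ | aeval u p = 0} v) :
    IsCompact O :=
  hcpt.of_isClosed_subset (isClosed_oval hO) (oval_subset_realLocus hO)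

/-- Every real zero lies on an oval of the indexing set. [folklore] -/
theorem mem_oval_of_aeval_eq_zero {v : Fin 2 → ℝ} (hv : aeval v p = 0) :
    connectedComponentIn {u : Fin 2 → ℝ | aeval u p = 0} v ∈
        {O : Set (Fin 2 → ℝ) | ∃ v : Fin 2 → ℝ, aeval v p = 0 ∧
          O = connectedComponentIn {u : Fin 2 → ℝ | aeval u p = 0} v} ∧
      v ∈ connectedComponentIn {u : Fin 2 → ℝ | aeval u p = 0} v :=
  ⟨⟨v, hv, rfl⟩, mem_connectedComponentIn hv⟩

end RealLocus

/-! ### The interior of an oval: open, bounded, of finite area -/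

section Interior

/-- The interior of a planar set (union of the bounded components of its complement) is a union
of complementary components: with each point it contains that point's whole component.
[folklore] -/
theorem connectedComponentIn_compl_subset_ovalInterior {O : Set (Fin 2 → ℝ)} {u : Fin 2 → ℝ}
    (hu : u ∈ ovalInterior O) : connectedComponentIn Oᶜ u ⊆ ovalInterior O := by
  intro u' hu'
  rw [mem_ovalInterior_iff] at hu ⊢
  refine ⟨connectedComponentIn_subset _ _ hu', ?_⟩
  rw [← connectedComponentIn_eq hu']
  exact hu.2

/-- The interior of a compact planar set is open (its complement is open in the locally
connected plane, so the complementary components are open). The closed-set version is proved on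
the Summits side (`…ComplexOrientationsComplexOrientationIdentity`); ovals are compact.
[folklore] -/
theorem isOpen_ovalInterior_of_isCompact {O : Set (Fin 2 → ℝ)} (hO : IsCompact O) :
    IsOpen (ovalInterior O) := by
  rw [isOpen_iff_mem_nhds]
  intro u hu
  have hopen : IsOpen (connectedComponentIn Oᶜ u) := hO.isClosed.isOpen_compl.connectedComponentIn
  exact Filter.mem_of_superset (hopen.mem_nhds (mem_connectedComponentIn hu.1))
    (connectedComponentIn_compl_subset_ovalInterior hu)

/-- The interior of a compact planar set is Lebesgue measurable. [folklore] -/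
theorem measurableSet_ovalInterior_of_isCompact {O : Set (Fin 2 → ℝ)} (hO : IsCompact O) :
    MeasurableSet (ovalInterior O) :=
  (isOpen_ovalInterior_of_isCompact hO).measurableSet

/-- **The interior stays in every ball about the origin containing the set**: if
`O ⊆ closedBall 0 R` then `ovalInterior O ⊆ closedBall 0 R` — a point `u` off the ball lies on
the ray `{t • u | t ≥ 1}`, a connected unbounded set missing `O`, so its complementary component
is unbounded. [folklore] -/
theorem ovalInterior_subset_closedBall {O : Set (Fin 2 → ℝ)} {R : ℝ} (hR : 0 ≤ R)
    (hO : O ⊆ Metric.closedBall 0 R) : ovalInterior O ⊆ Metric.closedBall 0 R := by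
  intro u hu
  by_contra hu'
  rw [Metric.mem_closedBall, dist_zero_right, not_le] at hu'
  have hupos : 0 < ‖u‖ := hR.trans_lt hu'
  -- the ray `t • u`, `t ≥ 1`, misses `O`
  have hray : (fun t : ℝ => t • u) '' Ici 1 ⊆ Oᶜ := by
    rintro _ ⟨t, ht, rfl⟩ hmem
    have h := hO hmem
    rw [Metric.mem_closedBall, dist_zero_right, norm_smul, Real.norm_eq_abs,
      abs_of_pos (lt_of_lt_of_le one_pos ht)] at h
    have : ‖u‖ ≤ t * ‖u‖ := by nlinarith [mem_Ici.1 ht]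
    linarith
  have hconn : IsPreconnected ((fun t : ℝ => t • u) '' Ici 1) :=
    isPreconnected_Ici.image _ (continuous_id.smul continuous_const).continuousOn
  have hsub : (fun t : ℝ => t • u) '' Ici 1 ⊆ connectedComponentIn Oᶜ u :=
    hconn.subset_connectedComponentIn ⟨1, mem_Ici.2 le_rfl, one_smul _ _⟩ hray
  -- but the ray is unbounded
  have hunb : ¬ IsBounded ((fun t : ℝ => t • u) '' Ici 1) := by
    intro hb
    obtain ⟨C, hC⟩ := hb.exists_norm_le
    set t : ℝ := max 1 (C / ‖u‖ + 1) with ht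
    have ht1 : 1 ≤ t := le_max_left _ _
    have h := hC (t • u) ⟨t, mem_Ici.2 ht1, rfl⟩
    rw [norm_smul, Real.norm_eq_abs, abs_of_pos (lt_of_lt_of_le one_pos ht1)] at h
    have h2 : C / ‖u‖ + 1 ≤ t := le_max_right _ _
    have key : (C / ‖u‖ + 1) * ‖u‖ = C + ‖u‖ := by
      field_simp
    have h3 : (C / ‖u‖ + 1) * ‖u‖ ≤ t * ‖u‖ := mul_le_mul_of_nonneg_right h2 hupos.le
    linarith
  exact hunb (((mem_ovalInterior_iff O u).1 hu).2.subset hsub)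

/-- The interior of a bounded planar set is bounded. [folklore] -/
theorem isBounded_ovalInterior {O : Set (Fin 2 → ℝ)} (hO : IsBounded O) :
    IsBounded (ovalInterior O) := by
  obtain ⟨R, hR⟩ := hO.subset_closedBall (0 : Fin 2 → ℝ)
  refine (Metric.isBounded_closedBall (x := (0 : Fin 2 → ℝ)) (r := max R 0)).subset ?_
  exact ovalInterior_subset_closedBall (le_max_right _ _)
    (hR.trans (Metric.closedBall_subset_closedBall (le_max_left _ _)))

/-- The interior of a bounded planar set has finite area, so that
`(volume (ovalInterior O)).toReal` is its Lebesgue area. [folklore] -/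
theorem volume_ovalInterior_lt_top {O : Set (Fin 2 → ℝ)} (hO : IsBounded O) :
    volume (ovalInterior O) < ⊤ :=
  (isBounded_ovalInterior hO).measure_lt_top

/-- For a compact real locus, the interior of every oval is an open bounded set of finite area.
[folklore] -/
theorem volume_ovalInterior_oval_lt_top {p : MvPolynomial (Fin 2) ℚ}
    (hcpt : IsCompact {v : Fin 2 → ℝ | aeval v p = 0}) {O : Set (Fin 2 → ℝ)}
    (hO : ∃ v : Fin 2 → ℝ, aeval v p = 0 ∧ O = connectedComponentIn {u : Fin 2 → ℝ | aeval u p = 0} v) :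
    volume (ovalInterior O) < ⊤ :=
  volume_ovalInterior_lt_top (isCompact_oval hcpt hO).isBounded

end Interior

/-! ### Nonsingularity at real points -/

section Gradient

variable {p : MvPolynomial (Fin 2) ℚ}

/-- The complex nonsingularity hypothesis of the fact, read at a real point: some real partial
derivative is non-zero. [folklore] -/
theorem exists_aeval_pderiv_ne_zero_real
    (hsm : ∀ w ∈ complexZeroLocus p, ∃ i, aeval w (pderiv i p) ≠ 0)
    {v : Fin 2 → ℝ} (hv : aeval v p = 0) : ∃ i, aeval v (pderiv i p) ≠ 0 := by
  obtain ⟨i, hi⟩ := hsm (fun j => (v j : ℂ)) ((ofReal_mem_complexZeroLocus_iff p v).2 hv)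
  refine ⟨i, fun h => hi ?_⟩
  rw [aeval_ofReal, h, Complex.ofReal_zero]

/-- Under the complex nonsingularity hypothesis the real gradient `∇p` vanishes nowhere on the
real locus. [folklore] -/
theorem realGrad_ne_zero (hsm : ∀ w ∈ complexZeroLocus p, ∃ i, aeval w (pderiv i p) ≠ 0)
    {v : Fin 2 → ℝ} (hv : aeval v p = 0) : realGrad p v ≠ 0 := by
  obtain ⟨i, hi⟩ := exists_aeval_pderiv_ne_zero_real hsm hv
  intro h
  apply hi
  have h' := congrFun h i
  rwa [realGrad_apply, Pi.zero_apply] at h'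

/-- Hence the positive tangent `J ∇p` vanishes nowhere on the real locus. [folklore] -/
theorem posTangent_ne_zero (hsm : ∀ w ∈ complexZeroLocus p, ∃ i, aeval w (pderiv i p) ≠ 0)
    {v : Fin 2 → ℝ} (hv : aeval v p = 0) : posTangent p v ≠ 0 := by
  intro h
  apply realGrad_ne_zero hsm hv
  have h0 := congrFun h 0
  have h1 := congrFun h 1
  simp only [posTangent, Matrix.cons_val_zero, Matrix.cons_val_one, Pi.zero_apply,
    neg_eq_zero] at h0 h1
  funext i
  fin_cases i
  · exact h1
  · exact h0

end Gradient

/-! ### Connectedness of the complex curve -/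

section Connected

/-- **A geometrically irreducible plane curve over `ℚ` is connected** in the classical topology
of `ℂ²`: the ideal `(p) ⊆ ℂ[x,y]` is prime (irreducible elements of the factorial ring `ℂ[x,y]`
are prime) and prime ideals have connected zero loci (Shafarevich's Theorem 7.1, in the tree).
This is the global input of Rokhlin's two-halves theorem.
[cite: Shafarevich1994, Book 3 Ch. VII §2 Thm. 7.1] -/
theorem isConnected_complexZeroLocus {p : MvPolynomial (Fin 2) ℚ}
    (hirr : Irreducible (map (algebraMap ℚ ℂ) p)) : IsConnected (complexZeroLocus p) := by
  set q : MvPolynomial (Fin 2) ℂ := map (algebraMap ℚ ℂ) p with hq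
  have hprime : (Ideal.span {q}).IsPrime := by
    rw [Ideal.span_singleton_prime hirr.ne_zero]
    exact hirr.prime
  have hconn := Literature.NumberTheory.Transcendental.isConnected_zeroLocus_of_isPrime_holds
    (Ideal.span {q}) hprime
  have hset : (MvPolynomial.zeroLocus ℂ (Ideal.span {q}) : Set (Fin 2 → ℂ)) =
      complexZeroLocus p := by
    ext w
    rw [MvPolynomial.zeroLocus_span, mem_setOf_eq, mem_complexZeroLocus_iff]
    simp only [mem_singleton_iff, forall_eq]
    rw [hq, aeval_map_algebraMap]
  rwa [hset] at hconn

/-- In particular the complex curve of an irreducible `p` is nonempty. [folklore] -/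
theorem complexZeroLocus_nonempty {p : MvPolynomial (Fin 2) ℚ}
    (hirr : Irreducible (map (algebraMap ℚ ℂ) p)) : (complexZeroLocus p).Nonempty :=
  (isConnected_complexZeroLocus hirr).nonempty

end Connected

/-! ### Reductions of the conclusion: conjugate half, empty real locus -/

section Reductions

variable (p : MvPolynomial (Fin 2) ℚ)

/-- **Opposite values for the two halves**: the signed area sum attached to `conj '' H` is the
negative of the one attached to `H` (`complexOrientationSign_image_star`).
[cite: Rokhlin1974, §2] -/
theorem finsum_sign_mul_area_image_star (H : Set (Fin 2 → ℂ)) :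
    ∑ᶠ O ∈ {O : Set (Fin 2 → ℝ) | ∃ v : Fin 2 → ℝ, aeval v p = 0 ∧
        O = connectedComponentIn {u : Fin 2 → ℝ | aeval u p = 0} v},
      (complexOrientationSign p (star '' H) O : ℝ) * (volume (ovalInterior O)).toReal =
    -∑ᶠ O ∈ {O : Set (Fin 2 → ℝ) | ∃ v : Fin 2 → ℝ, aeval v p = 0 ∧
        O = connectedComponentIn {u : Fin 2 → ℝ | aeval u p = 0} v},
      (complexOrientationSign p H O : ℝ) * (volume (ovalInterior O)).toReal := by
  have key : ∀ O : Set (Fin 2 → ℝ),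
      (complexOrientationSign p (star '' H) O : ℝ) * (volume (ovalInterior O)).toReal =
        -((complexOrientationSign p H O : ℝ) * (volume (ovalInterior O)).toReal) := fun O => by
    rw [complexOrientationSign_image_star, Int.cast_neg, neg_mul]
  simp_rw [key, finsum_neg_distrib]

/-- The conclusion of the fact for the conjugate half `conj '' H` follows from (indeed is
equivalent to) the conclusion for `H`, with `β ↦ -β`. [cite: Rokhlin1974, §2] -/
theorem rokhlinConclusion_image_star {H : Set (Fin 2 → ℂ)}
    (h : ∃ β : ℝ, IsAlgebraic ℚ β ∧
      ∑ᶠ O ∈ {O : Set (Fin 2 → ℝ) | ∃ v : Fin 2 → ℝ, aeval v p = 0 ∧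
          O = connectedComponentIn {u : Fin 2 → ℝ | aeval u p = 0} v},
        (complexOrientationSign p H O : ℝ) * (volume (ovalInterior O)).toReal = β * Real.pi) :
    ∃ β : ℝ, IsAlgebraic ℚ β ∧
      ∑ᶠ O ∈ {O : Set (Fin 2 → ℝ) | ∃ v : Fin 2 → ℝ, aeval v p = 0 ∧
          O = connectedComponentIn {u : Fin 2 → ℝ | aeval u p = 0} v},
        (complexOrientationSign p (star '' H) O : ℝ) * (volume (ovalInterior O)).toReal =
          β * Real.pi := by
  obtain ⟨β, hβ, hsum⟩ := h
  refine ⟨-β, hβ.neg, ?_⟩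
  rw [finsum_sign_mul_area_image_star, hsum, neg_mul]

/-- With an empty real locus the indexing set of ovals is empty. [folklore] -/
theorem setOf_oval_eq_empty (h : {v : Fin 2 → ℝ | aeval v p = 0} = ∅) :
    {O : Set (Fin 2 → ℝ) | ∃ v : Fin 2 → ℝ, aeval v p = 0 ∧
      O = connectedComponentIn {u : Fin 2 → ℝ | aeval u p = 0} v} = ∅ := by
  ext O
  simp only [mem_setOf_eq, mem_empty_iff_false, iff_false, not_exists, not_and]
  intro v hv _
  have hv' : v ∈ {v : Fin 2 → ℝ | aeval v p = 0} := hv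
  rw [h] at hv'
  exact hv'

/-- **Degenerate case of the fact**: if the real locus is empty, the signed area sum is the empty
sum and the conclusion holds with `β = 0`. [folklore] -/
theorem rokhlinConclusion_of_realLocus_eq_empty (h : {v : Fin 2 → ℝ | aeval v p = 0} = ∅)
    (H : Set (Fin 2 → ℂ)) :
    ∃ β : ℝ, IsAlgebraic ℚ β ∧
      ∑ᶠ O ∈ {O : Set (Fin 2 → ℝ) | ∃ v : Fin 2 → ℝ, aeval v p = 0 ∧
          O = connectedComponentIn {u : Fin 2 → ℝ | aeval u p = 0} v},
        (complexOrientationSign p H O : ℝ) * (volume (ovalInterior O)).toReal = β * Real.pi := by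
  refine ⟨0, isAlgebraic_zero, ?_⟩
  rw [setOf_oval_eq_empty p h, finsum_mem_empty, zero_mul]

end Reductions

/-! ### Areas by slicing along the lines `x - c y = ξ` (Cavalieri after a shear)

Layer 4 of the blueprint computes `Area(ovalInterior O)` by integrating the lengths of the slices
of `ovalInterior O` by the parallel lines `x - c y = ξ`, `c ∈ ℚ` a shear making `p(ξ + c y, y)`
monic in `y`. The shear `(ξ, y) ↦ (ξ + c y, y)` has determinant `1`, so this is Fubini. -/

section Slicing

/-- The sheared coordinate map `(ξ, y) ↦ (ξ + c y, y)` of `ℝ × ℝ` onto the plane is continuous.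
[folklore] -/
theorem continuous_shearCoord (c : ℝ) :
    Continuous fun q : ℝ × ℝ => (![q.1 + c * q.2, q.2] : Fin 2 → ℝ) := by
  have h0 : Continuous fun q : ℝ × ℝ => q.1 + c * q.2 := by fun_prop
  refine continuous_pi fun i => ?_
  fin_cases i
  · simpa using h0
  · simpa using continuous_snd

/-- The sheared coordinate map `(ξ, y) ↦ (ξ + c y, y)` preserves Lebesgue measure: it is the
composition of the measure-preserving identification `ℝ × ℝ ≃ ℝ²` with a linear shear of
determinant `1`. [folklore] -/
theorem measurePreserving_shearCoord (c : ℝ) :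
    MeasurePreserving (fun q : ℝ × ℝ => (![q.1 + c * q.2, q.2] : Fin 2 → ℝ)) volume volume := by
  classical
  -- the linear shear of `ℝ²`
  set A : Matrix (Fin 2) (Fin 2) ℝ := !![1, c; 0, 1] with hA
  set f : (Fin 2 → ℝ) →ₗ[ℝ] (Fin 2 → ℝ) := Matrix.toLin' A with hf
  have hdet : LinearMap.det f = 1 := by
    rw [hf, LinearMap.det_toLin', hA, Matrix.det_fin_two_of]
    ring
  have hfapply : ∀ v : Fin 2 → ℝ, f v = ![v 0 + c * v 1, v 1] := by
    intro v
    rw [hf, Matrix.toLin'_apply, hA]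
    ext i
    fin_cases i <;> simp [Matrix.mulVec, dotProduct, Fin.sum_univ_two]
  have hfm : Measurable f := f.continuous_of_finiteDimensional.measurable
  have hmapf : MeasurePreserving f volume volume := by
    refine ⟨hfm, ?_⟩
    rw [Real.map_linearMap_volume_pi_eq_smul_volume_pi (by rw [hdet]; exact one_ne_zero), hdet]
    simp
  -- compose with `finTwoArrow.symm : ℝ × ℝ → ℝ²`
  have hcomp : (fun q : ℝ × ℝ => (![q.1 + c * q.2, q.2] : Fin 2 → ℝ)) =
      f ∘ (MeasurableEquiv.finTwoArrow (α := ℝ)).symm := by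
    funext q
    rw [Function.comp_apply, MeasurableEquiv.finTwoArrow_symm_apply, hfapply]
    simp
  rw [hcomp]
  exact hmapf.comp (MeasureTheory.volume_preserving_finTwoArrow ℝ).symm

/-- **Cavalieri along sheared lines.** The area of a measurable planar set is the integral over
`ξ` of the lengths of its slices by the lines `{(ξ + c y, y) | y ∈ ℝ}` (`x - c y = ξ`).
[folklore] -/
theorem volume_eq_lintegral_volume_shearSlice (c : ℝ) {S : Set (Fin 2 → ℝ)}
    (hS : MeasurableSet S) :
    volume S = ∫⁻ ξ : ℝ, volume {y : ℝ | (![ξ + c * y, y] : Fin 2 → ℝ) ∈ S} := by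
  have hT : MeasurableSet {q : ℝ × ℝ | (![q.1 + c * q.2, q.2] : Fin 2 → ℝ) ∈ S} :=
    hS.preimage (continuous_shearCoord c).measurable
  have h1 : volume S = volume {q : ℝ × ℝ | (![q.1 + c * q.2, q.2] : Fin 2 → ℝ) ∈ S} :=
    ((measurePreserving_shearCoord c).measure_preimage hS.nullMeasurableSet).symm
  rw [h1, Measure.volume_eq_prod, Measure.prod_apply hT]
  rfl

/-- The slice-length function `ξ ↦ λ{y | (ξ + c y, y) ∈ S}` of a measurable planar set is
measurable. [folklore] -/
theorem measurable_volume_shearSlice (c : ℝ) {S : Set (Fin 2 → ℝ)} (hS : MeasurableSet S) :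
    Measurable fun ξ : ℝ => volume {y : ℝ | (![ξ + c * y, y] : Fin 2 → ℝ) ∈ S} := by
  have hT : MeasurableSet {q : ℝ × ℝ | (![q.1 + c * q.2, q.2] : Fin 2 → ℝ) ∈ S} :=
    hS.preimage (continuous_shearCoord c).measurable
  exact measurable_measure_prodMk_left hT

/-- The slices of a bounded planar set are uniformly bounded: if `S ⊆ closedBall 0 R` then every
slice `{y | (ξ + c y, y) ∈ S}` lies in `[-R, R]` (the sup norm dominates `|y|`). [folklore] -/
theorem shearSlice_subset_Icc (c : ℝ) {S : Set (Fin 2 → ℝ)} {R : ℝ}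
    (hS : S ⊆ Metric.closedBall 0 R) (ξ : ℝ) :
    {y : ℝ | (![ξ + c * y, y] : Fin 2 → ℝ) ∈ S} ⊆ Icc (-R) R := by
  intro y hy
  have h := hS hy
  rw [Metric.mem_closedBall, dist_zero_right] at h
  have h1 : ‖(![ξ + c * y, y] : Fin 2 → ℝ) 1‖ ≤ ‖(![ξ + c * y, y] : Fin 2 → ℝ)‖ := norm_le_pi_norm _ 1
  simp only [Matrix.cons_val_one, Matrix.cons_val_fin_one, Real.norm_eq_abs] at h1
  exact abs_le.1 (h1.trans h)

/-- The slice lengths of a bounded planar set are finite, bounded by the diameter of a ball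
containing it. [folklore] -/
theorem volume_shearSlice_le (c : ℝ) {S : Set (Fin 2 → ℝ)} {R : ℝ}
    (hS : S ⊆ Metric.closedBall 0 R) (ξ : ℝ) :
    volume {y : ℝ | (![ξ + c * y, y] : Fin 2 → ℝ) ∈ S} ≤ ENNReal.ofReal (R - (-R)) :=
  (measure_mono (shearSlice_subset_Icc c hS ξ)).trans Real.volume_Icc.le

/-- **Cavalieri along sheared lines, real-valued form** for bounded measurable sets: the area
`(volume S).toReal` is the Bochner integral of the real slice lengths. [folklore] -/
theorem volume_toReal_eq_integral_shearSlice (c : ℝ) {S : Set (Fin 2 → ℝ)}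
    (hS : MeasurableSet S) (hb : IsBounded S) :
    (volume S).toReal = ∫ ξ : ℝ, (volume {y : ℝ | (![ξ + c * y, y] : Fin 2 → ℝ) ∈ S}).toReal := by
  obtain ⟨R, hR⟩ := hb.subset_closedBall (0 : Fin 2 → ℝ)
  rw [volume_eq_lintegral_volume_shearSlice c hS, integral_toReal]
  · exact (measurable_volume_shearSlice c hS).aemeasurable
  · exact Filter.Eventually.of_forall fun ξ =>
      (volume_shearSlice_le c hR ξ).trans_lt ENNReal.ofReal_lt_top

/-- The interior of an oval of a compact real locus has area equal to the integral of its slice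
lengths along the lines `x - c y = ξ`, for every `c`. [folklore] -/
theorem volume_ovalInterior_toReal_eq_integral_shearSlice (c : ℝ) {p : MvPolynomial (Fin 2) ℚ}
    (hcpt : IsCompact {v : Fin 2 → ℝ | aeval v p = 0}) {O : Set (Fin 2 → ℝ)}
    (hO : ∃ v : Fin 2 → ℝ, aeval v p = 0 ∧ O = connectedComponentIn {u : Fin 2 → ℝ | aeval u p = 0} v) :
    (volume (ovalInterior O)).toReal =
      ∫ ξ : ℝ, (volume {y : ℝ | (![ξ + c * y, y] : Fin 2 → ℝ) ∈ ovalInterior O}).toReal :=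
  volume_toReal_eq_integral_shearSlice c (measurableSet_ovalInterior_of_isCompact (isCompact_oval hcpt hO))
    (isBounded_ovalInterior (isCompact_oval hcpt hO).isBounded)

end Slicing

/-! ### A rational shear makes the curve monic in `y`

Layers 4–6 of the blueprint project the curve to a line along the direction `(c, 1)`: in the
sheared coordinates `(ξ, y)`, `x = ξ + c y`, the polynomial `p(ξ + c Y, Y) ∈ ℚ[ξ][Y]` should be
of `Y`-degree `d = deg p` with CONSTANT leading coefficient, so that the fibres `{y | p(ξ + cy, y) = 0}`
are the `d` roots of a monic polynomial depending polynomially on `ξ` (no branch escapes to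
infinity over a finite `ξ`, the fibre sums of `y` are symmetric functions, and the Puiseux theory
at `ξ = ∞` of the tree applies). The coefficient of `Y^d` is the leading form of `p` evaluated at
`(c, 1)`, a non-zero polynomial in `c`, so all but finitely many `c ∈ ℚ` work. In this section
`shearV(K, c)` is local notation for the substitution `x ↦ ξ + c Y`, `y ↦ Y` into `K[ξ][Y]`
(`ξ = C X`, `Y = X`). -/

section Shear

/-- Local notation: the substitution `x ↦ ξ + c Y`, `y ↦ Y` into `K[ξ][Y] = Polynomial (Polynomial K)`
(inner variable `ξ = Polynomial.C Polynomial.X`, outer variable `Y = Polynomial.X`). -/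
local notation3 "shearV(" K ", " c ")" =>
  (![Polynomial.C Polynomial.X + Polynomial.C (Polynomial.C c) * Polynomial.X, Polynomial.X] :
    Fin 2 → Polynomial (Polynomial K))

namespace ShearMonic

variable {K : Type*} [Field K]

/-- **Evaluation of the sheared polynomial**: at `(ξ₀, y₀)` in a `K`-algebra, `p(ξ + cY, Y)`
evaluates to `p(ξ₀ + c y₀, y₀)`. [folklore] -/
theorem aevalTower_aeval_shear {A : Type*} [CommRing A] [Algebra K A] (c : K)
    (p : MvPolynomial (Fin 2) K) (ξ₀ y₀ : A) :
    Polynomial.aevalTower (Polynomial.aeval ξ₀) y₀ (aeval shearV(K, c) p) =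
      aeval ![ξ₀ + algebraMap K A c * y₀, y₀] p := by
  rw [comp_aeval_apply]
  have h : (fun i => Polynomial.aevalTower (Polynomial.aeval ξ₀) y₀ (shearV(K, c) i)) =
      ![ξ₀ + algebraMap K A c * y₀, y₀] := by
    funext i
    fin_cases i
    · simp [Polynomial.aevalTower_C, Polynomial.aevalTower_X]
    · simp [Polynomial.aevalTower_X]
  rw [h]

/-- The sheared monomial `(ξ + cY)^a Y^b` has `Y`-degree at most `a + b`. [folklore] -/
theorem natDegree_shear_monomial_le (c : K) (a b : ℕ) :
    ((Polynomial.C Polynomial.X + Polynomial.C (Polynomial.C c) * Polynomial.X) ^ a *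
        Polynomial.X ^ b : Polynomial (Polynomial K)).natDegree ≤ a + b := by
  refine Polynomial.natDegree_mul_le.trans ?_
  gcongr
  · refine Polynomial.natDegree_pow_le.trans ?_
    have h : (Polynomial.C Polynomial.X + Polynomial.C (Polynomial.C c) * Polynomial.X :
        Polynomial (Polynomial K)).natDegree ≤ 1 := by
      rw [add_comm]
      exact Polynomial.natDegree_linear_le
    calc a * _ ≤ a * 1 := Nat.mul_le_mul_left a h
      _ = a := mul_one a
  · exact Polynomial.natDegree_X_pow_le b

/-- The coefficient of `Y^{a+b}` in the sheared monomial `(ξ + cY)^a Y^b` is the constant `c^a`.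
[folklore] -/
theorem coeff_shear_monomial_top (c : K) (a b : ℕ) :
    ((Polynomial.C Polynomial.X + Polynomial.C (Polynomial.C c) * Polynomial.X) ^ a *
        Polynomial.X ^ b : Polynomial (Polynomial K)).coeff (a + b) = Polynomial.C c ^ a := by
  rw [Polynomial.coeff_mul_X_pow]
  have h : (Polynomial.C Polynomial.X + Polynomial.C (Polynomial.C c) * Polynomial.X :
      Polynomial (Polynomial K)).natDegree ≤ 1 := by
    rw [add_comm]
    exact Polynomial.natDegree_linear_le
  have := Polynomial.coeff_pow_of_natDegree_le (m := a) h
  rw [mul_one] at this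
  rw [this]
  simp

/-- The coefficient of `Y^d` in a sheared monomial of degree `a + b ≤ d`: `c^a` if `a + b = d`,
else `0`. [folklore] -/
theorem coeff_shear_monomial_eq (c : K) {a b d : ℕ} (h : a + b ≤ d) :
    ((Polynomial.C Polynomial.X + Polynomial.C (Polynomial.C c) * Polynomial.X) ^ a *
        Polynomial.X ^ b : Polynomial (Polynomial K)).coeff d =
      if a + b = d then Polynomial.C c ^ a else 0 := by
  split_ifs with hd
  · rw [← hd, coeff_shear_monomial_top]
  · exact Polynomial.coeff_eq_zero_of_natDegree_lt
      ((natDegree_shear_monomial_le c a b).trans_lt (lt_of_le_of_ne h hd))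

/-- Expansion of the sheared polynomial over the support of `p`. [folklore] -/
theorem aeval_shear_eq_sum (c : K) (p : MvPolynomial (Fin 2) K) :
    aeval shearV(K, c) p = ∑ m ∈ p.support, Polynomial.C (Polynomial.C (coeff m p)) *
      ((Polynomial.C Polynomial.X + Polynomial.C (Polynomial.C c) * Polynomial.X) ^ (m 0) *
        Polynomial.X ^ (m 1)) := by
  conv_lhs => rw [p.as_sum]
  rw [map_sum]
  refine Finset.sum_congr rfl fun m _ => ?_
  rw [aeval_monomial, Finsupp.prod_fintype _ _ (fun i => by simp), Fin.prod_univ_two]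
  simp only [Matrix.cons_val_zero, Matrix.cons_val_one, Matrix.cons_val_fin_one]
  rfl

/-- Monomials in the support have degree `m 0 + m 1` at most the total degree. [folklore] -/
theorem deg_le_of_mem_support {p : MvPolynomial (Fin 2) K} {m : Fin 2 →₀ ℕ} (hm : m ∈ p.support) :
    m 0 + m 1 ≤ p.totalDegree := by
  have h : (m.sum fun _ e => e) = m 0 + m 1 := by
    rw [Finsupp.sum_fintype _ _ (fun _ => rfl), Fin.sum_univ_two]
  rw [← h]
  exact le_totalDegree hm

/-- **Degree bound**: the sheared polynomial `p(ξ + cY, Y)` has `Y`-degree at most the total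
degree of `p`. [folklore] -/
theorem natDegree_aeval_shear_le (c : K) (p : MvPolynomial (Fin 2) K) :
    (aeval shearV(K, c) p).natDegree ≤ p.totalDegree := by
  rw [aeval_shear_eq_sum]
  refine Polynomial.natDegree_sum_le_of_forall_le _ _ fun m hm => ?_
  refine Polynomial.natDegree_C_mul_le _ _ |>.trans ?_
  exact (natDegree_shear_monomial_le c _ _).trans (deg_le_of_mem_support hm)

/-- **Top coefficient**: the coefficient of `Y^d` in `p(ξ + cY, Y)`, `d` the total degree of `p`,
is the CONSTANT `Σ_{|m| = d} coeff m p · c^{m 0}` — the leading form of `p` evaluated at `(c, 1)`.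
[folklore] -/
theorem coeff_aeval_shear_totalDegree (c : K) (p : MvPolynomial (Fin 2) K) :
    (aeval shearV(K, c) p).coeff p.totalDegree =
      Polynomial.C (∑ m ∈ p.support.filter (fun m => m 0 + m 1 = p.totalDegree),
        coeff m p * c ^ (m 0)) := by
  rw [aeval_shear_eq_sum, Polynomial.finsetSum_coeff, map_sum, Finset.sum_filter]
  refine Finset.sum_congr rfl fun m hm => ?_
  rw [Polynomial.coeff_C_mul, coeff_shear_monomial_eq c (deg_le_of_mem_support hm)]
  split_ifs with h
  · simp
  · simp

/-- The leading form of `p ≠ 0` evaluated at `(t, 1)`, as a univariate polynomial in `t`, is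
non-zero: distinct top-degree monomials `x^a y^{d-a}` give distinct powers `t^a`. [folklore] -/
theorem leadingFormPoly_ne_zero {p : MvPolynomial (Fin 2) K} (hp : p ≠ 0) :
    (∑ m ∈ p.support.filter (fun m => m 0 + m 1 = p.totalDegree),
        Polynomial.C (coeff m p) * Polynomial.X ^ (m 0) : Polynomial K) ≠ 0 := by
  -- a monomial of top degree
  obtain ⟨m₀, hm₀, hdeg⟩ : ∃ m₀ ∈ p.support, m₀ 0 + m₀ 1 = p.totalDegree := by
    obtain ⟨m₀, hm₀, h⟩ := Finset.exists_mem_eq_sup p.support (support_nonempty.2 hp)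
      (fun s : Fin 2 →₀ ℕ => s.sum fun _ e => e)
    refine ⟨m₀, hm₀, ?_⟩
    rw [← Fin.sum_univ_two (f := fun i => m₀ i), ← Finsupp.sum_fintype m₀ (fun _ e => e) (fun _ => rfl)]
    exact h.symm
  intro h
  have hc := congrArg (fun q : Polynomial K => q.coeff (m₀ 0)) h
  simp only [Polynomial.finsetSum_coeff, Polynomial.coeff_C_mul, Polynomial.coeff_X_pow,
    mul_ite, mul_one, mul_zero, Polynomial.coeff_zero] at hc
  rw [Finset.sum_ite, Finset.sum_const_zero, add_zero] at hc
  have hset : (p.support.filter (fun m => m 0 + m 1 = p.totalDegree)).filter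
      (fun m => m₀ 0 = m 0) = {m₀} := by
    ext m
    simp only [Finset.mem_filter, Finset.mem_singleton, mem_support_iff]
    constructor
    · rintro ⟨⟨-, hm⟩, h0⟩
      ext i
      fin_cases i
      · exact h0.symm
      · simp only [Fin.mk_one]
        omega
    · rintro rfl
      exact ⟨⟨mem_support_iff.1 hm₀, hdeg⟩, rfl⟩
  rw [hset, Finset.sum_singleton] at hc
  exact (mem_support_iff.1 hm₀) hc

/-- Over an infinite field some shear parameter `c` makes the top coefficient non-zero (a
non-zero polynomial has a non-root). [folklore] -/
theorem exists_eval_leadingFormPoly_ne_zero [Infinite K] {p : MvPolynomial (Fin 2) K} (hp : p ≠ 0) :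
    ∃ c : K, ∑ m ∈ p.support.filter (fun m => m 0 + m 1 = p.totalDegree),
        coeff m p * c ^ (m 0) ≠ 0 := by
  by_contra hall
  push Not at hall
  apply leadingFormPoly_ne_zero hp
  apply Polynomial.eq_zero_of_infinite_isRoot
  refine Set.infinite_univ.mono fun c _ => ?_
  simp only [Set.mem_setOf_eq, Polynomial.IsRoot.def, Polynomial.eval_finsetSum,
    Polynomial.eval_mul, Polynomial.eval_C, Polynomial.eval_pow, Polynomial.eval_X]
  exact hall c

/-- **A rational shear makes the curve monic in `y`.** For `p ≠ 0` over an infinite field `K`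
there are `c a ∈ K`, `a ≠ 0`, such that `p(ξ + c Y, Y) ∈ K[ξ][Y]` has `Y`-degree exactly the
total degree of `p` and CONSTANT leading coefficient `a`. [folklore] -/
theorem exists_shear_natDegree_eq [Infinite K] {p : MvPolynomial (Fin 2) K} (hp : p ≠ 0) :
    ∃ c a : K, a ≠ 0 ∧ (aeval shearV(K, c) p).natDegree = p.totalDegree ∧
      (aeval shearV(K, c) p).leadingCoeff = Polynomial.C a := by
  obtain ⟨c, hc⟩ := exists_eval_leadingFormPoly_ne_zero hp
  refine ⟨c, _, hc, ?_⟩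
  have hcoeff := coeff_aeval_shear_totalDegree c p
  have hne : (aeval shearV(K, c) p).coeff p.totalDegree ≠ 0 := by
    rw [hcoeff]
    exact Polynomial.C_ne_zero.2 hc
  have hdeg : (aeval shearV(K, c) p).natDegree = p.totalDegree :=
    le_antisymm (natDegree_aeval_shear_le c p) (Polynomial.le_natDegree_of_ne_zero hne)
  refine ⟨hdeg, ?_⟩
  rw [Polynomial.leadingCoeff, hdeg, hcoeff]

/-- Consequently, for such a shear, at every `ξ₀` in a `K`-algebra domain `A` the univariate
polynomial `Y ↦ p(ξ₀ + cY, Y)` has degree `d` and leading coefficient `a`: no root escapes to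
infinity over a finite `ξ₀`. [folklore] -/
theorem natDegree_map_shear {A : Type*} [CommRing A] [IsDomain A] [Algebra K A] {c a : K} (ha : a ≠ 0)
    {p : MvPolynomial (Fin 2) K} (hdeg : (aeval shearV(K, c) p).natDegree = p.totalDegree)
    (hlead : (aeval shearV(K, c) p).leadingCoeff = Polynomial.C a) [FaithfulSMul K A] (ξ₀ : A) :
    ((aeval shearV(K, c) p).map (Polynomial.aeval ξ₀ : Polynomial K →ₐ[K] A).toRingHom).natDegree =
      p.totalDegree ∧
    ((aeval shearV(K, c) p).map (Polynomial.aeval ξ₀ : Polynomial K →ₐ[K] A).toRingHom).leadingCoeff =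
      algebraMap K A a := by
  have h : (Polynomial.aeval ξ₀ : Polynomial K →ₐ[K] A).toRingHom (aeval shearV(K, c) p).leadingCoeff ≠ 0 := by
    rw [hlead]
    simp only [AlgHom.toRingHom_eq_coe, RingHom.coe_coe, Polynomial.aeval_C]
    exact (map_ne_zero_iff _ (FaithfulSMul.algebraMap_injective K A)).2 ha
  refine ⟨?_, ?_⟩
  · rw [Polynomial.natDegree_map_of_leadingCoeff_ne_zero _ h, hdeg]
  · rw [Polynomial.leadingCoeff_map_of_leadingCoeff_ne_zero _ h, hlead]
    simp

end ShearMonic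

end Shear

/-! ### Uniqueness of divergent asymptotic expansions (for the contour at infinity, layer 6) -/

section Asymptotics

open Filter
open scoped _root_.Topology

/-- **Uniqueness of a divergent asymptotic expansion.** If `Σ_{q ∈ s} R^q • c_q + C + g(R)`,
with finitely many exponents `q > 0` and `g → 0`, is eventually equal to a constant `L` as
`R → ∞`, then every `c_q` vanishes and `L = C` (divide by the largest power and let `R → ∞`;
induction on the number of exponents). This kills the divergent terms of the contour integral at
infinity in layer 6, whose total is constant because `J` has compact support. [folklore] -/
theorem eq_zero_of_eventually_sum_rpow_smul_eq {E : Type*} [NormedAddCommGroup E] [NormedSpace ℝ E]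
    (s : Finset ℝ) (hs : ∀ q ∈ s, 0 < q) (c : ℝ → E) (C L : E) (g : ℝ → E)
    (hg : Tendsto g atTop (𝓝 0)) (h : ∀ᶠ R in atTop, ∑ q ∈ s, (R ^ q) • c q + C + g R = L) :
    (∀ q ∈ s, c q = 0) ∧ L = C := by
  induction s using Finset.induction_on_max with
  | empty =>
    refine ⟨fun q hq => (Finset.notMem_empty q hq).elim, ?_⟩
    simp only [Finset.sum_empty, zero_add] at h
    have h1 : Tendsto (fun R => C + g R) atTop (𝓝 L) :=
      tendsto_const_nhds.congr' (h.mono fun R hR => hR.symm)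
    have h2 : Tendsto (fun R => C + g R) atTop (𝓝 (C + 0)) := tendsto_const_nhds.add hg
    rw [add_zero] at h2
    exact tendsto_nhds_unique h1 h2
  | insert m s hlt ih =>
    -- first `c m = 0`: divide by `R ^ m`
    have hm : 0 < m := hs m (Finset.mem_insert_self m s)
    have hs' : ∀ q ∈ s, 0 < q := fun q hq => hs q (Finset.mem_insert_of_mem hq)
    have hms : m ∉ s := fun hm' => lt_irrefl m (hlt m hm')
    have key : Tendsto (fun R : ℝ => (R ^ (-m)) • (L - C - g R) - ∑ q ∈ s, (R ^ (q - m)) • c q)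
        atTop (𝓝 (c m)) := by
      refine tendsto_const_nhds.congr' ?_
      filter_upwards [h, eventually_gt_atTop 0] with R hR hR0
      rw [Finset.sum_insert hms] at hR
      -- `R^m • c m = L - C - g R - Σ_{s}`
      have e1 : (R ^ m) • c m = L - C - g R - ∑ q ∈ s, (R ^ q) • c q := by
        rw [← hR]; abel
      have hRm : R ^ (-m) * R ^ m = 1 := by
        rw [Real.rpow_neg hR0.le, inv_mul_cancel₀ (Real.rpow_pos_of_pos hR0 m).ne']
      calc c m = (R ^ (-m) * R ^ m) • c m := by rw [hRm, one_smul]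
        _ = (R ^ (-m)) • ((R ^ m) • c m) := by rw [mul_smul]
        _ = (R ^ (-m)) • (L - C - g R) - ∑ q ∈ s, (R ^ (q - m)) • c q := by
          rw [e1, smul_sub, Finset.smul_sum, sub_right_inj]
          refine Finset.sum_congr rfl fun q _ => ?_
          rw [smul_smul, ← Real.rpow_add hR0, neg_add_eq_sub]
    have lim : Tendsto (fun R : ℝ => (R ^ (-m)) • (L - C - g R) - ∑ q ∈ s, (R ^ (q - m)) • c q)
        atTop (𝓝 (0 - 0)) := by
      refine Tendsto.sub ?_ ?_
      · have h1 : Tendsto (fun R : ℝ => R ^ (-m)) atTop (𝓝 0) := tendsto_rpow_neg_atTop hm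
        have h2 : Tendsto (fun R => L - C - g R) atTop (𝓝 (L - C - 0)) :=
          tendsto_const_nhds.sub hg
        simpa using h1.smul h2
      · rw [← Finset.sum_const_zero (s := s)]
        refine tendsto_finsetSum _ fun q hq => ?_
        have hq : q - m < 0 := sub_neg.2 (hlt q hq)
        have h1 : Tendsto (fun R : ℝ => R ^ (q - m)) atTop (𝓝 0) := by
          have := tendsto_rpow_neg_atTop (y := m - q) (by linarith)
          refine this.congr fun R => ?_
          rw [neg_sub]
        simpa using h1.smul_const (c q)
    rw [sub_zero] at lim
    have hcm : c m = 0 := tendsto_nhds_unique key lim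
    -- now induct
    have h' : ∀ᶠ R in atTop, ∑ q ∈ s, (R ^ q) • c q + C + g R = L := by
      filter_upwards [h] with R hR
      rwa [Finset.sum_insert hms, hcm, smul_zero, zero_add] at hR
    obtain ⟨hc, hL⟩ := ih hs' h'
    refine ⟨fun q hq => ?_, hL⟩
    rcases Finset.mem_insert.1 hq with rfl | hq
    · exact hcm
    · exact hc q hq

end Asymptotics

/-! ### Fibres of a `Y`-monic family over `ℚ[ξ]` (for the fibre sums of layer 5)

For `Q ∈ ℚ[ξ][Y]` with `natDegree Q = d` and constant leading coefficient `C a`, `a ≠ 0` (as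
produced by `ShearMonic.exists_shear_natDegree_eq`), the fibre over `ξ₀ ∈ ℂ` is a complex
polynomial of degree `d` with leading coefficient `a`: its `d` roots are bounded by a continuous
function of `ξ₀` and their sum is the polynomial `-Q_{d-1}(ξ₀)/a`. -/

section Fibres

open Polynomial

namespace ShearMonic

/-- Local notation: the fibre polynomial over `ξ₀ ∈ ℂ` — specialise the coefficients of
`Q ∈ ℚ[ξ][Y]` at `ξ = ξ₀`. -/
local notation3 "fibre(" Q ", " ξ₀ ")" =>
  (Polynomial.map (Polynomial.aeval ξ₀ : Polynomial ℚ →ₐ[ℚ] ℂ).toRingHom Q : Polynomial ℂ)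

/-- The coefficients of the fibre polynomial are the specialised coefficients. [folklore] -/
theorem coeff_fibre (Q : Polynomial (Polynomial ℚ)) (ξ₀ : ℂ) (i : ℕ) :
    (fibre(Q, ξ₀)).coeff i = Polynomial.aeval ξ₀ (Q.coeff i) := by
  rw [Polynomial.coeff_map]
  rfl

variable {Q : Polynomial (Polynomial ℚ)} {a : ℚ} {d : ℕ}

/-- Degree `d` and leading coefficient `a` of every fibre of a `Y`-monic family
(`natDegree Q = d`, `leadingCoeff Q = C a`, `a ≠ 0`). [folklore] -/
theorem natDegree_fibre (hdeg : Q.natDegree = d) (hlead : Q.leadingCoeff = Polynomial.C a) (ha : a ≠ 0)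
    (ξ₀ : ℂ) : (fibre(Q, ξ₀)).natDegree = d ∧ (fibre(Q, ξ₀)).leadingCoeff = (a : ℂ) := by
  have h : (Polynomial.aeval ξ₀ : Polynomial ℚ →ₐ[ℚ] ℂ).toRingHom Q.leadingCoeff ≠ 0 := by
    rw [hlead]
    simp only [AlgHom.toRingHom_eq_coe, RingHom.coe_coe, Polynomial.aeval_C, eq_ratCast, ne_eq,
      Rat.cast_eq_zero]
    exact ha
  refine ⟨?_, ?_⟩
  · rw [Polynomial.natDegree_map_of_leadingCoeff_ne_zero _ h, hdeg]
  · rw [Polynomial.leadingCoeff_map_of_leadingCoeff_ne_zero _ h, hlead]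
    simp

/-- The fibres of a `Y`-monic family are non-zero polynomials. [folklore] -/
theorem fibre_ne_zero (hdeg : Q.natDegree = d) (hlead : Q.leadingCoeff = Polynomial.C a) (ha : a ≠ 0)
    (ξ₀ : ℂ) : fibre(Q, ξ₀) ≠ 0 := by
  intro h
  have := (natDegree_fibre hdeg hlead ha ξ₀).2
  rw [h, Polynomial.leadingCoeff_zero] at this
  exact ha (by exact_mod_cast this.symm)

/-- **Root bound, uniform in `ξ₀`**: every root `y` of the fibre polynomial over `ξ₀` satisfies
`‖y‖ ≤ 1 + (Σ_{i<d} ‖Q_i(ξ₀)‖)/‖a‖` — a continuous function of `ξ₀`; so the fibres stay bounded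
over bounded sets of `ξ₀` (no root escapes to infinity over a finite `ξ₀`; layer 5: the fibre
sums are bounded near branch points). [folklore] -/
theorem norm_root_fibre_le (hdeg : Q.natDegree = d) (hlead : Q.leadingCoeff = Polynomial.C a)
    (ha : a ≠ 0) {ξ₀ y : ℂ} (hy : (fibre(Q, ξ₀)).IsRoot y) :
    ‖y‖ ≤ (∑ i ∈ Finset.range d, ‖Polynomial.aeval ξ₀ (Q.coeff i)‖) / ‖(a : ℂ)‖ + 1 := by
  have hne := fibre_ne_zero hdeg hlead ha ξ₀
  have hlt := hy.norm_lt_cauchyBound hne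
  obtain ⟨hd, hl⟩ := natDegree_fibre hdeg hlead ha ξ₀
  have hcb : (cauchyBound fibre(Q, ξ₀) : ℝ) ≤
      (∑ i ∈ Finset.range d, ‖Polynomial.aeval ξ₀ (Q.coeff i)‖) / ‖(a : ℂ)‖ + 1 := by
    rw [cauchyBound, hd, hl]
    push_cast
    gcongr
    -- sup ≤ sum
    have : (((Finset.range d).sup fun i => ‖(fibre(Q, ξ₀)).coeff i‖₊ : NNReal) : ℝ) ≤
        ∑ i ∈ Finset.range d, (‖(fibre(Q, ξ₀)).coeff i‖₊ : ℝ) := by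
      rw [← NNReal.coe_sum]
      exact_mod_cast Finset.sup_le fun i hi =>
        Finset.single_le_sum (f := fun i => ‖(fibre(Q, ξ₀)).coeff i‖₊) (fun _ _ => zero_le) hi
    refine this.trans (le_of_eq ?_)
    refine Finset.sum_congr rfl fun i _ => ?_
    rw [coe_nnnorm, coeff_fibre]
  have : (‖y‖₊ : ℝ) < cauchyBound fibre(Q, ξ₀) := by exact_mod_cast hlt
  rw [coe_nnnorm] at this
  exact (this.le).trans hcb

/-- The root bound of `norm_root_fibre_le` is a continuous function of `ξ₀`. [folklore] -/
theorem continuous_rootBound (Q : Polynomial (Polynomial ℚ)) (a : ℚ) (d : ℕ) :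
    Continuous fun ξ₀ : ℂ =>
      (∑ i ∈ Finset.range d, ‖Polynomial.aeval ξ₀ (Q.coeff i)‖) / ‖(a : ℂ)‖ + 1 := by
  refine ((continuous_finsetSum _ fun i _ => ?_).div_const _).add continuous_const
  exact (Polynomial.continuous_aeval _).norm

/-- **Vieta for the fibres**: for `d > 0` the sum of the `d` roots of the fibre polynomial over
`ξ₀` (with multiplicity) is `-Q_{d-1}(ξ₀)/a`, a polynomial function of `ξ₀` over `ℚ` (layer 5:
`e₁ ∈ ℚ[ξ]`). [folklore] -/
theorem sum_roots_fibre (hdeg : Q.natDegree = d) (hlead : Q.leadingCoeff = Polynomial.C a)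
    (ha : a ≠ 0) (hd : 0 < d) (ξ₀ : ℂ) :
    (fibre(Q, ξ₀)).roots.sum = -Polynomial.aeval ξ₀ (Q.coeff (d - 1)) / (a : ℂ) := by
  obtain ⟨hd', hl⟩ := natDegree_fibre hdeg hlead ha ξ₀
  have hsplit : (fibre(Q, ξ₀)).Splits := IsAlgClosed.splits _
  have h := hsplit.nextCoeff_eq_neg_sum_roots_mul_leadingCoeff
  rw [hl, Polynomial.nextCoeff_of_natDegree_pos (by rw [hd']; exact hd), hd', coeff_fibre] at h
  have ha' : (a : ℂ) ≠ 0 := by exact_mod_cast ha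
  field_simp
  linear_combination h

/-- Every fibre of a `Y`-monic family of degree `d` has exactly `d` roots in `ℂ` counted with
multiplicity. [folklore] -/
theorem card_roots_fibre (hdeg : Q.natDegree = d) (hlead : Q.leadingCoeff = Polynomial.C a)
    (ha : a ≠ 0) (ξ₀ : ℂ) : Multiset.card (fibre(Q, ξ₀)).roots = d := by
  obtain ⟨hd', -⟩ := natDegree_fibre hdeg hlead ha ξ₀
  rw [← hd']
  exact (IsAlgClosed.splits _).natDegree_eq_card_roots.symm

end ShearMonic

end Fibres

end Literature.AlgebraicGeometry.RealAlgebraic
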